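import Mathlib
import Summits.Ventures.PercRepro2.TwoHullMasterCube

/-!
# Theta graphs: a path is a cube side, the two-vertex gluing of cube sides is a cube side, and
(MM) on every parallel composition of paths (blind cell PercRepro2, night-4 g39, 2026-08-29;
proofs/NIGHT4-G39.md §7, Theorem 4)

`cubeSide_path`: the interface involution with the first edge's colour makes a path a cube side of
dimension `Unit`.  `cubeSide_glue2`: if both sides of a two-vertex cut `{l, h}` are cube sides, the
glued graph is a cube side of dimension `ι₁ ⊕ ι₂` (the hull pairs are the unions of the side
pairs on `U`, `hullPair_glue2_l` / `_h`).  Hence (MM) holds on every theta graph — any number of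
internally disjoint `l`–`h` paths glued at their ends — by `twoHullMaster_of_cubeSide`;
`twoHullMaster_theta3` states the case of three paths, which the character expansion of the
record (Theorem 3) could not settle for general up-sets.
-/

namespace Summit.Ventures.PercRepro2

namespace Glue2

open Hull LocRows Path2

open scoped Classical

variable {V : Type*}

/-! ## §4 A path is a cube side; the two-vertex gluing of cube sides is a cube side -/

section Instances

/-- The cube action of a path: flip the head where the single coordinate is set. -/
noncomputable def pathOrb {k : ℕ} (ε : Unit → Bool) (ζ : Config (Fin k)) : Config (Fin k) :=
  if ε () then flipHead ζ else ζ

/-- **A path is a cube side of dimension `Unit`.** -/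
theorem cubeSide_path {k : ℕ} {p : Fin (k + 1) → V} (hp : Function.Injective p) :
    CubeSide (pathEnds p) (p 0) (p (Fin.last k)) Unit pathOrb (fun _ => headColour)
      (fun _ ζ => hullPair (pathEnds p) ζ (p 0)) (fun _ ζ => hullPair (pathEnds p) ζ (p (Fin.last k)))
      (fun _ ζ => hullPair (pathEnds p) (flipHead ζ) (p (Fin.last k))) where
  orb_zero ζ := by simp [pathOrb]
  mem ζ hU ε := by
    simp only [pathOrb]
    split_ifs
    · rw [last_notMem_hull_iff hp] at hU ⊢; exact not_isConst_flipHead hU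
    · exact hU
  orb_orb ζ _ ε ε' := by
    simp only [pathOrb, cubeXor]
    rcases Bool.eq_false_or_eq_true (ε ()) with h1 | h1 <;>
      rcases Bool.eq_false_or_eq_true (ε' ()) with h2 | h2 <;> simp [h1, h2, flipHead_flipHead]
  l_pair ζ hU ε := by
    rw [unionPairs_unit]
    rcases Bool.eq_false_or_eq_true (ε ()) with h1 | h1
    · simp only [pathOrb, h1, if_true]
      rw [last_notMem_hull_iff hp] at hU
      exact hullPair_zero_flipHead hp hU
    · simp [pathOrb, h1]
  h_pair ζ _ ε := by
    rw [unionPairs_unit]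
    rcases Bool.eq_false_or_eq_true (ε ()) with h1 | h1
    · simp only [pathOrb, h1, if_true]
    · simp [pathOrb, h1]
  up ζ hU _ hc := by
    rw [last_notMem_hull_iff hp] at hU
    exact (hullPair_last_flipHead_move hp hU).1 hc
  down ζ hU _ hc := by
    rw [last_notMem_hull_iff hp] at hU
    exact (hullPair_last_flipHead_move hp hU).2 hc
  dia_up ζ hU _ hc := by
    rw [last_notMem_hull_iff hp] at hU
    exact diamond_path_up hp hU hc
  dia_down ζ hU _ hc := by
    rw [last_notMem_hull_iff hp] at hU
    exact diamond_path_down hp hU hc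

variable {E₁ E₂ : Type*} {ends₁ : E₁ → Sym2 V} {ends₂ : E₂ → Sym2 V} {l h : V} {V₁ V₂ : Set V}
  {ι₁ ι₂ : Type*} {orb₁ : (ι₁ → Bool) → Config E₁ → Config E₁} {c₁ : ι₁ → Config E₁ → Bool}
  {Q₁ T₁ T₁' : ι₁ → Config E₁ → Set V × Set V}
  {orb₂ : (ι₂ → Bool) → Config E₂ → Config E₂} {c₂ : ι₂ → Config E₂ → Bool}
  {Q₂ T₂ T₂' : ι₂ → Config E₂ → Set V × Set V}

/-- The cube action of a two-vertex gluing: act on each side with its coordinates. -/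
def glueOrb (orb₁ : (ι₁ → Bool) → Config E₁ → Config E₁)
    (orb₂ : (ι₂ → Bool) → Config E₂ → Config E₂) (ε : ι₁ ⊕ ι₂ → Bool)
    (ζ : Config (E₁ ⊕ E₂)) : Config (E₁ ⊕ E₂) :=
  pair2 (orb₁ (ε ∘ Sum.inl) (ζ ∘ Sum.inl)) (orb₂ (ε ∘ Sum.inr) (ζ ∘ Sum.inr))

/-- A family on the sum of the coordinates, from the two side families. -/
def glueFam {X : Type*} (f₁ : ι₁ → Config E₁ → X) (f₂ : ι₂ → Config E₂ → X) :
    ι₁ ⊕ ι₂ → Config (E₁ ⊕ E₂) → X :=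
  Sum.elim (fun j ζ => f₁ j (ζ ∘ Sum.inl)) (fun j ζ => f₂ j (ζ ∘ Sum.inr))

/-- **The two-vertex gluing of two cube sides is a cube side** of dimension `ι₁ ⊕ ι₂`. -/
theorem cubeSide_glue2 (hg : IsGluing2 ends₁ ends₂ l h V₁ V₂)
    (h₁ : CubeSide ends₁ l h ι₁ orb₁ c₁ Q₁ T₁ T₁') (h₂ : CubeSide ends₂ l h ι₂ orb₂ c₂ Q₂ T₂ T₂') :
    CubeSide (glue2 ends₁ ends₂) l h (ι₁ ⊕ ι₂) (glueOrb orb₁ orb₂) (glueFam c₁ c₂)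
      (glueFam Q₁ Q₂) (glueFam T₁ T₂) (glueFam T₁' T₂') where
  orb_zero ζ := by
    simp only [glueOrb]
    have e1 : ((fun _ : ι₁ ⊕ ι₂ => false) ∘ Sum.inl) = fun _ : ι₁ => false := rfl
    have e2 : ((fun _ : ι₁ ⊕ ι₂ => false) ∘ Sum.inr) = fun _ : ι₂ => false := rfl
    rw [e1, e2, h₁.orb_zero, h₂.orb_zero, pair2_sides]
  mem ζ hU ε := by
    rw [notMem_hull_glue2_iff hg] at hU ⊢
    simp only [glueOrb, pair2_inl, pair2_inr]
    exact ⟨h₁.mem _ hU.1 _, h₂.mem _ hU.2 _⟩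
  orb_orb ζ hU ε ε' := by
    rw [notMem_hull_glue2_iff hg] at hU
    simp only [glueOrb, pair2_inl, pair2_inr]
    rw [h₁.orb_orb _ hU.1, h₂.orb_orb _ hU.2]
    rfl
  l_pair ζ hU ε := by
    have hU' : h ∉ hull (glue2 ends₁ ends₂) (glueOrb orb₁ orb₂ ε ζ) l := by
      rw [notMem_hull_glue2_iff hg] at hU ⊢
      simp only [glueOrb, pair2_inl, pair2_inr]
      exact ⟨h₁.mem _ hU.1 _, h₂.mem _ hU.2 _⟩
    rw [notMem_hull_glue2_iff hg] at hU
    rw [hullPair_glue2_l hg hU', unionPairs_sum]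
    simp only [glueOrb, pair2_inl, pair2_inr, h₁.l_pair _ hU.1, h₂.l_pair _ hU.2, glueFam,
      Sum.elim_inl, Sum.elim_inr, Function.comp]
    rfl
  h_pair ζ hU ε := by
    have hU' : h ∉ hull (glue2 ends₁ ends₂) (glueOrb orb₁ orb₂ ε ζ) l := by
      rw [notMem_hull_glue2_iff hg] at hU ⊢
      simp only [glueOrb, pair2_inl, pair2_inr]
      exact ⟨h₁.mem _ hU.1 _, h₂.mem _ hU.2 _⟩
    rw [notMem_hull_glue2_iff hg] at hU
    rw [hullPair_glue2_h hg hU', unionPairs_sum]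
    simp only [glueOrb, pair2_inl, pair2_inr, h₁.h_pair _ hU.1, h₂.h_pair _ hU.2, glueFam,
      Sum.elim_inl, Sum.elim_inr, Function.comp]
    rfl
  up ζ hU j hc := by
    rw [notMem_hull_glue2_iff hg] at hU
    rcases j with j | j
    · exact h₁.up _ hU.1 j hc
    · exact h₂.up _ hU.2 j hc
  down ζ hU j hc := by
    rw [notMem_hull_glue2_iff hg] at hU
    rcases j with j | j
    · exact h₁.down _ hU.1 j hc
    · exact h₂.down _ hU.2 j hc
  dia_up ζ hU j hc := by
    rw [notMem_hull_glue2_iff hg] at hU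
    rcases j with j | j
    · exact h₁.dia_up _ hU.1 j hc
    · exact h₂.dia_up _ hU.2 j hc
  dia_down ζ hU j hc := by
    rw [notMem_hull_glue2_iff hg] at hU
    rcases j with j | j
    · exact h₁.dia_down _ hU.1 j hc
    · exact h₂.dia_down _ hU.2 j hc

end Instances

/-! ## §5 Theta graphs -/

/-- **(MM) on the theta graph with three paths** `Θ(k₁, k₂, k₃)`: the first path glued at its ends
to the gluing of the second and the third — the case `r = 3` that the character expansion left
open. -/
theorem twoHullMaster_theta3 {k₁ k₂ k₃ : ℕ} {p₁ : Fin (k₁ + 1) → V} {p₂ : Fin (k₂ + 1) → V}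
    {p₃ : Fin (k₃ + 1) → V} (hp₁ : Function.Injective p₁) (hp₂ : Function.Injective p₂)
    (hp₃ : Function.Injective p₃) {V₂ V₃ V₁ V₂₃ : Set V}
    (hg₂₃ : IsGluing2 (pathEnds p₂) (pathEnds p₃) (p₁ 0) (p₁ (Fin.last k₁)) V₂ V₃)
    (hg₁ : IsGluing2 (pathEnds p₁) (glue2 (pathEnds p₂) (pathEnds p₃)) (p₁ 0) (p₁ (Fin.last k₁)) V₁ V₂₃)
    (h0₂ : p₂ 0 = p₁ 0) (hl₂ : p₂ (Fin.last k₂) = p₁ (Fin.last k₁))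
    (h0₃ : p₃ 0 = p₁ 0) (hl₃ : p₃ (Fin.last k₃) = p₁ (Fin.last k₁)) :
    TwoHullMaster (glue2 (pathEnds p₁) (glue2 (pathEnds p₂) (pathEnds p₃))) (p₁ 0) (p₁ (Fin.last k₁)) := by
  have s₂ : CubeSide (pathEnds p₂) (p₁ 0) (p₁ (Fin.last k₁)) Unit pathOrb (fun _ => headColour)
      (fun _ ζ => hullPair (pathEnds p₂) ζ (p₁ 0))
      (fun _ ζ => hullPair (pathEnds p₂) ζ (p₁ (Fin.last k₁)))
      (fun _ ζ => hullPair (pathEnds p₂) (flipHead ζ) (p₁ (Fin.last k₁))) := by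
    rw [← h0₂, ← hl₂]; exact cubeSide_path hp₂
  have s₃ : CubeSide (pathEnds p₃) (p₁ 0) (p₁ (Fin.last k₁)) Unit pathOrb (fun _ => headColour)
      (fun _ ζ => hullPair (pathEnds p₃) ζ (p₁ 0))
      (fun _ ζ => hullPair (pathEnds p₃) ζ (p₁ (Fin.last k₁)))
      (fun _ ζ => hullPair (pathEnds p₃) (flipHead ζ) (p₁ (Fin.last k₁))) := by
    rw [← h0₃, ← hl₃]; exact cubeSide_path hp₃
  exact twoHullMaster_of_cubeSide (cubeSide_glue2 hg₁ (cubeSide_path hp₁) (cubeSide_glue2 hg₂₃ s₂ s₃))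


end Glue2

end Summit.Ventures.PercRepro2
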